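import Summits.Ventures.YMGap.YM3IR.BalabanCeilings
import Summits.Ventures.YMGap.RobustBall.TorusRowsSUNStar
import HarnessLib

/-!
# YM3IR / BalabanCeilingsSUNStar — the §Y4 sentence for EVERY `SU(N)`, `N ≥ 2`, on ds-2's HYPOTHESIS-FREE every-`N` robust-star rows
('t Hooft ceiling `t = 1/24` on BOTH tiers; working rows `1/32`, `1/40`), with the counted crossover (theorems only; no new conjecture name)

HONEST FRAMING (cell pub-ymgap, track Y4 / YM3-IR, seat ym3ir-theory-1, gen 11; follow-up to `YM3IR/BalabanCeilings.lean`, whose every-`N`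
sentences `massGap3Cofinal_suN_balaban_free_of_irConjecture3` (tier 1, p1's single-link row, 't Hooft ceiling `1/40`, ball
`ClusterDomainFR (87/500) (87/1000) r`) and `massGap3Cofinal_suN_W_free_of_irConjecture3(Cov)` (tier 2, 't Hooft ceiling `1/64`) were the
every-`N` receiving ends of record, written once ds-2 (g9)'s `RobustBall/TorusRowsSUNStar.lean` — ONE exact-rational certificate for ALL
`N ≥ 2` of the robust vertex-star door in the variance form on the tree's hypothesis-free all-`N` Bakry–Émery pair
(`oneLinkPoincareSUN_bakryEmery`, `oneLinkVarianceBound_bakryEmery`), radii and rates FREE OF `N` — was in the tree (R212 (iii)).  This file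
claims NO summit, NO mass gap and NO part of Bałaban's theorems.  It is kernel-checked BOOKKEEPING: `BalabanSUN.massGap3Cofinal_suN_balaban_of_irConjecture3`
for every `N ≥ 2` with track Y2's input (`ClusterDomainClustering` on the receiving ball) DISCHARGED BY NAME by ds-2's hypothesis-free
every-`N` `d = 3` rows: TIER 1 `RobustBall.suN_clusterDomainClustering_dim3_star_24 hN r` ('t Hooft ceiling `1/24`, i.e. tree ceiling `N/24`,
Wilson `β_W = N²/24`; ball `ClusterDomainFR (3/50) (3/100) r`, some rate `m > 0`), working rows `…_star_32` (`1/32`; ball `(119/500, 119/1000)`)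
and `…_star_40` (`1/40` = the ceiling of the sentence of record with the ball DOUBLED: `(42/125, 21/125)` vs p1's `(87/500, 87/1000)`);
TIER 2 `RobustBall.suN_clusterDomainClusteringW_dim3_star_24_t100 hN κ_b hκb` ('t Hooft ceiling `1/24`; weighted ball
`ClusterDomain κ_b (29/500) (29/1000)` for every `κ_b ≥ 1/100`, rate `1/100`) and working row `…W_dim3_star_32_t100` (`1/32`; ball
`(117/500, 117/1000)`).  WHAT MOVES on the UV side: the HYPOTHESIS-FREE every-`N` receiving end of the §Y4 sentence rises from 't Hooft
`1/40` (tier 1) and `1/64` (tier 2, the ball in which the conjecture of record is typed) to `1/24` on BOTH tiers — for `SU(2)` and `SU(3)` the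
group-specific files stay higher (`BalabanCeilings` §2 / `BalabanCeilingsSU2W`: Wilson `1/2`; `BalabanCeilingsSU3PV` / `…SU3PVW`: Wilson
`12/25` / `2/5`; certified GIVEN H1/H2: `3/4`), so the content of this file is `N ≥ 4` and the `N`-uniformity of radii and rates.  Lattice
statements only; strong-coupling constants; no continuum limit, no Millennium claim; no axiom, no `sorry`, no `def`; `0` compute.

THE HYPOTHESIS LIST, VERBATIM (`massGap3Cofinal_suN_balaban_star_24_of_irConjecture3`): `2 ≤ N`; `BalabanUV3 mk` — IN PRINT (Bałaban, CMP
102 (1985), Thm 1 p. 257 + Thm 2 p. 272, every `SU(N)`), logically IDLE in the arrow (theory-2 F2; R196); `Nonempty (Family L eps0)` — print's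
clauses at one coupling (p. 256 L15–18); `0 < C_b`, `0 < κ`;
`IRConjecture3 (ballOfRobustBallFR N (3/50) (3/100) r (N·(1/24))) suFrobDist (fundamentalRep (Fin N)) (balabanCouplings L (suGroupModel N) eps0)
C_b κ` — the CONJECTURE of record (theory-2, `YM3IR/Statement.lean`; NOT in print).  LABEL OF RECORD (R196, verbatim): a typed INTERFACE /
dictionary, NOT a reduction — with existential `(C_b, κ)` the free-family conjecture is target-equivalent on every receiving ball in the tree
(theory-2, `YM3IR/ForestWitness.lean`, `YM3IR/ForestWitnessSUN.lean`: the forest witness enters any ball containing product Haar,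
`ForestWitnessSUN.forestWitness3_of_piHaarMem`); the covariant form `IRConjecture3Cov` (`YM3IR/CovariantFamily.lean`) is a genuine sufficient
condition, possibly strictly stronger, converse NOT known — never "the remaining gap".  CONCLUSION:
`MassGap3Cofinal (balabanCouplings L (suGroupModel N) eps0) suFrobDist (fundamentalRep (Fin N))`.

COUNTED CROSSOVER (PROVED arithmetic, tree units `β = β_W/N`, 't Hooft `t = β_W/N²`): below the ceiling `N·(1/24)` after `K + M'` steps iff
`L^{M'} ≥ 24/(N² γ₀²)` (`suN_betaTree_div_pow_le_row24_iff`, the instance `t = 1/24` of `BalabanCeilings.suN_betaTree_div_pow_le_tHooft_iff`);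
since `γ₀² ≤ 1` this forces `24/N² ≤ L^{M'}` (`suN_row24_crossover_steps`) — `M' ≥ 1` still for `N ≤ 4` (`suN_row24_crossover_pos`), vacuous
AS TYPED for `N ≥ 5` (print's smallness of `γ₀` and its `N`-dependence are not typed, so no claim that `M' = 0` is realised) — vs
`40/(N² γ₀²)` (tier 1) and `64/(N² γ₀²)` (tier 2) on the rows of record.

WHY THIS IS USEFUL (one sentence).  It records, by name and kernel-checked, the every-`N` §Y4 sentence with Y2's input ONE hypothesis-free
theorem for all `N ≥ 2` at the highest every-`N` `d = 3` ceiling in the tree, on both receiving tiers, and what that leaves for the crossover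
(`L^{M'} ≥ 24/(N² γ₀²)`).

References: T. Bałaban, CMP 102 (1985) 255–275, p. 256 L15–18, (5) p. 256, Thm 1 p. 257, Thm 2 p. 272 [cite: Balaban1985UV3]; CMP 98 (1985)
17–51, (11), (15) p. 19 [cite: Balaban1985Averaging] (block locality = a property of the average (15), no numbered display); D. Bakry,
M. Émery (1985) and R. Holley, D. Stroock (1987) (the one-link pair behind ds-2's rows; ds-2's file header).
-/

noncomputable section

open MeasureTheory
open Literature.MathematicalPhysics.QuantumLattice Literature.MathematicalPhysics.QuantumFieldTheory
open Balaban1985CMP102 Balaban1985CMP102.Setting Balaban1985CMP102.Theorems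
open Literature.MathematicalPhysics.QuantumFieldTheory.Balaban1983to89 (GaugeGroup HaarData)
open Summit.QuantumFields.Balaban3D.Carriers (suGroupModel)

namespace Summit.Ventures.YMGap.YM3IR

open CarrierBridge

/-! ## §1  Every `SU(N)`, `N ≥ 2`, TIER 1: 't Hooft ceiling `1/24` (ds-2's every-`N` robust-star row BY NAME) -/

/-- **`SU(N)` lattice YM₃ mass gap on Bałaban's coupling set, EVERY `N ≥ 2`, receiving at 't Hooft `t = 1/24` (tree `N/24`, Wilson
`β_W = N²/24`), Y2's input HYPOTHESIS-FREE (PROVED bookkeeping).**  ds-2's every-`N` tier-1 row `RobustBall.suN_clusterDomainClustering_dim3_star_24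
hN r` BY NAME (ball `ClusterDomainFR (3/50) (3/100) r`, radii free of `N`, some rate `m > 0`).  The hypothesis that is neither in print nor
certified is `IRConjecture3` (label of record R196: a dictionary, not a reduction; `BalabanUV3 mk` is logically idle).
[cite: Balaban1985UV3, Thm 1 p.257; Thm 2 p.272] -/
theorem massGap3Cofinal_suN_balaban_star_24_of_irConjecture3 {N L : ℕ} [NeZero N] (hN : 2 ≤ N) {mk : Construction L}
    {eps0 : ℝ → ℝ} (hfam : Nonempty (Family L eps0)) (r : ℕ) {C_b κ : ℝ} (hC : 0 < C_b) (hκ : 0 < κ)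
    (hUV : BalabanUV3 mk)
    (hIR : IRConjecture3 (ballOfRobustBallFR N (3 / 50) (3 / 100) r ((N : ℝ) * (1 / 24))) suFrobDist
      (fundamentalRep (Fin N)) (balabanCouplings L (suGroupModel N) eps0) C_b κ) :
    MassGap3Cofinal (balabanCouplings L (suGroupModel N) eps0) suFrobDist
      (fundamentalRep (Fin N) : RobustBall.SUN N →* Matrix (Fin N) (Fin N) ℂ) := by
  obtain ⟨m, hm, hRB, -⟩ := RobustBall.suN_clusterDomainClustering_dim3_star_24 hN r
  exact massGap3Cofinal_suN_balaban_of_irConjecture3 hfam hC hκ hm hUV hRB hIR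

/-- **The same from the COVARIANT conjecture (PROVED bookkeeping; `IRConjecture3Cov ⟹ IRConjecture3`).**  Recorded for completeness only:
images of gauge-covariant local averaging are expected to have infinite range at every `β > 0`, so the covariant conjecture is better received
on the tier-2 weighted balls (§2). LABEL OF RECORD for `IRConjecture3Cov` (R196, verbatim): «⟹ target PROVED; converse NOT KNOWN; a genuine
sufficient condition, possibly strictly stronger, never "the remaining gap"». [cite: Balaban1985Averaging, (11), (15) p.19] -/
theorem massGap3Cofinal_suN_balaban_star_24_of_irConjecture3Cov {N L : ℕ} [NeZero N] (hN : 2 ≤ N) {mk : Construction L}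
    {eps0 : ℝ → ℝ} (hfam : Nonempty (Family L eps0)) (r : ℕ) {C_b κ : ℝ} (hC : 0 < C_b) (hκ : 0 < κ)
    (hUV : BalabanUV3 mk)
    (hIR : IRConjecture3Cov (ballOfRobustBallFR N (3 / 50) (3 / 100) r ((N : ℝ) * (1 / 24))) suFrobDist
      (fundamentalRep (Fin N)) (balabanCouplings L (suGroupModel N) eps0) C_b κ) :
    MassGap3Cofinal (balabanCouplings L (suGroupModel N) eps0) suFrobDist
      (fundamentalRep (Fin N) : RobustBall.SUN N →* Matrix (Fin N) (Fin N) ℂ) :=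
  massGap3Cofinal_suN_balaban_star_24_of_irConjecture3 hN hfam r hC hκ hUV (irConjecture3_of_cov hIR)

/-- **Every `N ≥ 2` in PRINT'S quantifier order at 't Hooft `1/24` (PROVED bookkeeping):** from `BalabanUV3 mk`, at THEOREM 2's own
terminal spacing `ε₀` for `SU(N)`: for every finite range `r` and positive `C_b, κ`, `Nonempty (Family L eps0) → IRConjecture3` on the row's
ball (label of record R196: a dictionary, not a reduction) `⟹ MassGap3Cofinal` — Y2's input certified for every `N`.
[cite: Balaban1985UV3, p.256 L15–18; Thm 2 p.272] -/
theorem massGap3Cofinal_suN_balaban_star_24_printedOrder_of_irConjecture3 {N L : ℕ} [NeZero N] (hN : 2 ≤ N)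
    (mk : Construction L) (hUV : BalabanUV3 mk) :
    ∃ eps0 : ℝ → ℝ, (∀ g : ℝ, 0 < g → 0 < eps0 g) ∧
      (∀ S : Family L eps0, ∀ k, k ≤ S.1.K → (mk (RobustBall.SUN N) (suGroupModel N) S.1).ineq41_47 k) ∧
      ∀ (r : ℕ) (C_b κ : ℝ), 0 < C_b → 0 < κ → Nonempty (Family L eps0) →
        IRConjecture3 (ballOfRobustBallFR N (3 / 50) (3 / 100) r ((N : ℝ) * (1 / 24))) suFrobDist
          (fundamentalRep (Fin N)) (balabanCouplings L (suGroupModel N) eps0) C_b κ →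
          MassGap3Cofinal (balabanCouplings L (suGroupModel N) eps0) suFrobDist
            (fundamentalRep (Fin N) : RobustBall.SUN N →* Matrix (Fin N) (Fin N) ℂ) := by
  obtain ⟨eps0, hpos, h2, h⟩ := massGap3Cofinal_suN_balaban_printedOrder_of_irConjecture3 (N := N) mk hUV
  refine ⟨eps0, hpos, h2, fun r C_b κ hC hκ hfam hIR => ?_⟩
  obtain ⟨m, hm, hRB, -⟩ := RobustBall.suN_clusterDomainClustering_dim3_star_24 hN r
  exact h (ballOfRobustBallFR N (3 / 50) (3 / 100) r ((N : ℝ) * (1 / 24))) C_b κ m hC hκ hm hfam hRB hIR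

/-- **Working row, every `N ≥ 2`, TIER 1 at 't Hooft `1/32` on the larger ball `ClusterDomainFR (119/500) (119/1000) r` (PROVED
bookkeeping):** ds-2's row `RobustBall.suN_clusterDomainClustering_dim3_star_32 hN r` BY NAME. [cite: Balaban1985UV3, Thm 1 p.257; Thm 2 p.272] -/
theorem massGap3Cofinal_suN_balaban_star_32_of_irConjecture3 {N L : ℕ} [NeZero N] (hN : 2 ≤ N) {mk : Construction L}
    {eps0 : ℝ → ℝ} (hfam : Nonempty (Family L eps0)) (r : ℕ) {C_b κ : ℝ} (hC : 0 < C_b) (hκ : 0 < κ)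
    (hUV : BalabanUV3 mk)
    (hIR : IRConjecture3 (ballOfRobustBallFR N (119 / 500) (119 / 1000) r ((N : ℝ) * (1 / 32))) suFrobDist
      (fundamentalRep (Fin N)) (balabanCouplings L (suGroupModel N) eps0) C_b κ) :
    MassGap3Cofinal (balabanCouplings L (suGroupModel N) eps0) suFrobDist
      (fundamentalRep (Fin N) : RobustBall.SUN N →* Matrix (Fin N) (Fin N) ℂ) := by
  obtain ⟨m, hm, hRB, -⟩ := RobustBall.suN_clusterDomainClustering_dim3_star_32 hN r
  exact massGap3Cofinal_suN_balaban_of_irConjecture3 hfam hC hκ hm hUV hRB hIR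

/-- **At the ceiling of the sentence of record ('t Hooft `1/40`) with the ball DOUBLED (PROVED bookkeeping):** ds-2's every-`N` star row
`RobustBall.suN_clusterDomainClustering_dim3_star_40 hN r` BY NAME receives on `ClusterDomainFR (42/125) (21/125) r` where p1's single-link row
behind `BalabanCeilings.massGap3Cofinal_suN_balaban_free_of_irConjecture3` received on `ClusterDomainFR (87/500) (87/1000) r` — same ceiling, a
visibly larger perturbation ball for the conjecture to land in. [cite: Balaban1985UV3, Thm 1 p.257; Thm 2 p.272] -/
theorem massGap3Cofinal_suN_balaban_star_40_of_irConjecture3 {N L : ℕ} [NeZero N] (hN : 2 ≤ N) {mk : Construction L}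
    {eps0 : ℝ → ℝ} (hfam : Nonempty (Family L eps0)) (r : ℕ) {C_b κ : ℝ} (hC : 0 < C_b) (hκ : 0 < κ)
    (hUV : BalabanUV3 mk)
    (hIR : IRConjecture3 (ballOfRobustBallFR N (42 / 125) (21 / 125) r ((N : ℝ) * (1 / 40))) suFrobDist
      (fundamentalRep (Fin N)) (balabanCouplings L (suGroupModel N) eps0) C_b κ) :
    MassGap3Cofinal (balabanCouplings L (suGroupModel N) eps0) suFrobDist
      (fundamentalRep (Fin N) : RobustBall.SUN N →* Matrix (Fin N) (Fin N) ℂ) := by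
  obtain ⟨m, hm, hRB, -⟩ := RobustBall.suN_clusterDomainClustering_dim3_star_40 hN r
  exact massGap3Cofinal_suN_balaban_of_irConjecture3 hfam hC hκ hm hUV hRB hIR

/-! ## §2  Every `SU(N)`, `N ≥ 2`, TIER 2 (the weighted ball the covariant sentences receive on): 't Hooft ceiling `1/24`, rate `1/100` -/

/-- **Every `N ≥ 2`, TIER 2 at 't Hooft `1/24`, Y2's input HYPOTHESIS-FREE (PROVED bookkeeping).**  ds-2's every-`N` weighted row
`RobustBall.suN_clusterDomainClusteringW_dim3_star_24_t100 hN κ_b hκb` BY NAME — ball `ClusterDomain κ_b (29/500) (29/1000)` for every ball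
parameter `κ_b ≥ 1/100`, rate `1/100`, radii and rate free of `N` — where the tier-2 sentence of record
`BalabanCeilings.massGap3Cofinal_suN_W_free_of_irConjecture3` received at 't Hooft `1/64`. [cite: Balaban1985UV3, Thm 1 p.257; Thm 2 p.272] -/
theorem massGap3Cofinal_suN_W_star_24_of_irConjecture3 {N L : ℕ} [NeZero N] (hN : 2 ≤ N) {mk : Construction L}
    {eps0 : ℝ → ℝ} (hfam : Nonempty (Family L eps0)) {κ_b C_b κ : ℝ} (hκb : 1 / 100 ≤ κ_b) (hC : 0 < C_b) (hκ : 0 < κ)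
    (hUV : BalabanUV3 mk)
    (hIR : IRConjecture3 (ballOfRobustBall N κ_b (29 / 500) (29 / 1000) ((N : ℝ) * (1 / 24))) suFrobDist
      (fundamentalRep (Fin N)) (balabanCouplings L (suGroupModel N) eps0) C_b κ) :
    MassGap3Cofinal (balabanCouplings L (suGroupModel N) eps0) suFrobDist
      (fundamentalRep (Fin N) : RobustBall.SUN N →* Matrix (Fin N) (Fin N) ℂ) :=
  massGap3Cofinal_suN_balaban_of_irConjecture3 hfam hC hκ (by norm_num : (0 : ℝ) < 1 / 100) hUV
    (RobustBall.suN_clusterDomainClusteringW_dim3_star_24_t100 hN κ_b hκb).1 hIR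

/-- **Every `N ≥ 2` from print ∧ the COVARIANT conjecture on the tier-2 ball at 't Hooft `1/24` (PROVED bookkeeping; the §Y4 sentence shape
of `CovariantFamily.massGap3Cofinal_su2_W_of_irConjecture3Cov` / `BalabanCeilings.massGap3Cofinal_suN_W_free_of_irConjecture3Cov`, ceiling
`1/64 ↦ 1/24`).**  LABEL OF RECORD for `IRConjecture3Cov` (R196, verbatim): «⟹ target PROVED; converse NOT KNOWN; a genuine sufficient condition,
possibly strictly stronger, never "the remaining gap"». [cite: Balaban1985Averaging, (11), (15) p.19] -/
theorem massGap3Cofinal_suN_W_star_24_of_irConjecture3Cov {N L : ℕ} [NeZero N] (hN : 2 ≤ N) {mk : Construction L}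
    {eps0 : ℝ → ℝ} (hfam : Nonempty (Family L eps0)) {κ_b C_b κ : ℝ} (hκb : 1 / 100 ≤ κ_b) (hC : 0 < C_b) (hκ : 0 < κ)
    (hUV : BalabanUV3 mk)
    (hIR : IRConjecture3Cov (ballOfRobustBall N κ_b (29 / 500) (29 / 1000) ((N : ℝ) * (1 / 24))) suFrobDist
      (fundamentalRep (Fin N)) (balabanCouplings L (suGroupModel N) eps0) C_b κ) :
    MassGap3Cofinal (balabanCouplings L (suGroupModel N) eps0) suFrobDist
      (fundamentalRep (Fin N) : RobustBall.SUN N →* Matrix (Fin N) (Fin N) ℂ) :=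
  massGap3Cofinal_suN_W_star_24_of_irConjecture3 hN hfam hκb hC hκ hUV (irConjecture3_of_cov hIR)

/-- **The same, PRINT-FREE (theory-2's F2 shape: `BalabanUV3 mk` and `mk` deleted; PROVED bookkeeping), every `N ≥ 2`.**  What remains of
print is the index set `balabanCouplings` and its unboundedness — the kernel record that `BalabanUV3` is evidential in these sentences.
[cite: Balaban1985UV3, p.256 L15–18] -/
theorem massGap3Cofinal_suN_W_star_24_of_irConjecture3Cov_printFree {N L : ℕ} [NeZero N] (hN : 2 ≤ N) {eps0 : ℝ → ℝ}
    (hfam : Nonempty (Family L eps0)) {κ_b C_b κ : ℝ} (hκb : 1 / 100 ≤ κ_b) (hC : 0 < C_b) (hκ : 0 < κ)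
    (hIR : IRConjecture3Cov (ballOfRobustBall N κ_b (29 / 500) (29 / 1000) ((N : ℝ) * (1 / 24))) suFrobDist
      (fundamentalRep (Fin N)) (balabanCouplings L (suGroupModel N) eps0) C_b κ) :
    MassGap3Cofinal (balabanCouplings L (suGroupModel N) eps0) suFrobDist
      (fundamentalRep (Fin N) : RobustBall.SUN N →* Matrix (Fin N) (Fin N) ℂ) :=
  massGap3Cofinal_of_irConjecture3_printFree (not_bddAbove_balabanCouplings (suGroupModel N) hfam) hC hκ
    (by norm_num : (0 : ℝ) < 1 / 100) (suFrobDist_bddAbove N)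
    (RobustBall.suN_clusterDomainClusteringW_dim3_star_24_t100 hN κ_b hκb).1 (irConjecture3_of_cov hIR)

/-- **In PRINT'S quantifier order on the tier-2 ball at 't Hooft `1/24`, every `N ≥ 2` (PROVED bookkeeping):** `∃ eps0` first (print, p. 256
L15–18), then for every ball parameter `κ_b ≥ 1/100` and every `C_b`, `κ`: `Nonempty (Family L eps0) → IRConjecture3` on the row's ball
`⟹ MassGap3Cofinal`. [cite: Balaban1985UV3, p.256 L15–18; Thm 2 p.272] -/
theorem massGap3Cofinal_suN_W_star_24_printedOrder_of_irConjecture3 {N L : ℕ} [NeZero N] (hN : 2 ≤ N) (mk : Construction L)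
    (hUV : BalabanUV3 mk) :
    ∃ eps0 : ℝ → ℝ, (∀ g : ℝ, 0 < g → 0 < eps0 g) ∧
      (∀ S : Family L eps0, ∀ k, k ≤ S.1.K → (mk (RobustBall.SUN N) (suGroupModel N) S.1).ineq41_47 k) ∧
      ∀ (κ_b C_b κ : ℝ), 1 / 100 ≤ κ_b → 0 < C_b → 0 < κ → Nonempty (Family L eps0) →
        IRConjecture3 (ballOfRobustBall N κ_b (29 / 500) (29 / 1000) ((N : ℝ) * (1 / 24))) suFrobDist
          (fundamentalRep (Fin N)) (balabanCouplings L (suGroupModel N) eps0) C_b κ →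
          MassGap3Cofinal (balabanCouplings L (suGroupModel N) eps0) suFrobDist
            (fundamentalRep (Fin N) : RobustBall.SUN N →* Matrix (Fin N) (Fin N) ℂ) := by
  obtain ⟨eps0, hpos, h2, h⟩ := massGap3Cofinal_suN_balaban_printedOrder_of_irConjecture3 (N := N) mk hUV
  refine ⟨eps0, hpos, h2, fun κ_b C_b κ hκb hC hκ hfam hIR => ?_⟩
  exact h (ballOfRobustBall N κ_b (29 / 500) (29 / 1000) ((N : ℝ) * (1 / 24))) C_b κ (1 / 100) hC hκ
    (by norm_num : (0 : ℝ) < 1 / 100) hfam (RobustBall.suN_clusterDomainClusteringW_dim3_star_24_t100 hN κ_b hκb).1 hIR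

/-- **Working row, every `N ≥ 2`, TIER 2 at 't Hooft `1/32` on the larger weighted ball `ClusterDomain κ_b (117/500) (117/1000)`, rate
`1/100`, from the COVARIANT conjecture (PROVED bookkeeping):** ds-2's row `RobustBall.suN_clusterDomainClusteringW_dim3_star_32_t100 hN κ_b hκb`
BY NAME. LABEL OF RECORD for `IRConjecture3Cov` (R196, verbatim) as above. [cite: Balaban1985Averaging, (11), (15) p.19] -/
theorem massGap3Cofinal_suN_W_star_32_of_irConjecture3Cov {N L : ℕ} [NeZero N] (hN : 2 ≤ N) {mk : Construction L}
    {eps0 : ℝ → ℝ} (hfam : Nonempty (Family L eps0)) {κ_b C_b κ : ℝ} (hκb : 1 / 100 ≤ κ_b) (hC : 0 < C_b) (hκ : 0 < κ)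
    (hUV : BalabanUV3 mk)
    (hIR : IRConjecture3Cov (ballOfRobustBall N κ_b (117 / 500) (117 / 1000) ((N : ℝ) * (1 / 32))) suFrobDist
      (fundamentalRep (Fin N)) (balabanCouplings L (suGroupModel N) eps0) C_b κ) :
    MassGap3Cofinal (balabanCouplings L (suGroupModel N) eps0) suFrobDist
      (fundamentalRep (Fin N) : RobustBall.SUN N →* Matrix (Fin N) (Fin N) ℂ) :=
  massGap3Cofinal_suN_balaban_of_irConjecture3 hfam hC hκ (by norm_num : (0 : ℝ) < 1 / 100) hUV
    (RobustBall.suN_clusterDomainClusteringW_dim3_star_32_t100 hN κ_b hκb).1 (irConjecture3_of_cov hIR)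

/-! ## §3  «At which β_eff»: the counted crossover against the every-`N` ceiling `1/24` (PROVED arithmetic) -/

/-- **Every `N`, ds-2's row `t = 1/24` (tree ceiling `N/24`; PROVED arithmetic):** a family member's canonical-scaling tree coupling after
`K + M'` steps is below the ceiling iff `L^{M'} ≥ 24/(N² γ₀²)` — the instance `t = 1/24` of `suN_betaTree_div_pow_le_tHooft_iff`.
[cite: Balaban1985UV3, (5) p.256] -/
theorem suN_betaTree_div_pow_le_row24_iff {N L : ℕ} [NeZero N] (S : Scales L) (M' : ℕ) :
    betaTree (suGroupModel N) S / (L : ℝ) ^ (S.K + M') ≤ (N : ℝ) * (1 / 24) ↔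
      24 / ((N : ℝ) ^ 2 * Dictionary.gammaSq S) ≤ (L : ℝ) ^ M' := by
  rw [suN_betaTree_div_pow_le_tHooft_iff S M' (by norm_num : (0 : ℝ) < 1 / 24)]
  have e : ((N : ℝ) ^ 2 * Dictionary.gammaSq S * (1 / 24))⁻¹ = 24 / ((N : ℝ) ^ 2 * Dictionary.gammaSq S) := by
    rw [one_div, _root_.mul_inv, inv_inv, mul_comm (((N : ℝ) ^ 2 * Dictionary.gammaSq S)⁻¹) 24, div_eq_mul_inv]
  rw [e]

/-- Hence on ds-2's every-`N` row (PROVED arithmetic; `γ₀² ≤ 1`): in the window after `K + M'` steps forces `24/N² ≤ L^{M'}` — `≥ 6` for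
`SU(2)`, `≥ 8/3` for `SU(3)`, `≥ 3/2` for `SU(4)`; vacuous AS TYPED for `N ≥ 5` (print's smallness of `γ₀` and its `N`-dependence are not
typed, so no claim that `M' = 0` is realised). [cite: Balaban1985UV3, (5) p.256] -/
theorem suN_row24_crossover_steps {N L : ℕ} [NeZero N] (S : Scales L) (M' : ℕ)
    (h : betaTree (suGroupModel N) S / (L : ℝ) ^ (S.K + M') ≤ (N : ℝ) * (1 / 24)) :
    24 / (N : ℝ) ^ 2 ≤ (L : ℝ) ^ M' := by
  have hN : (0 : ℝ) < N := by exact_mod_cast Nat.pos_of_ne_zero (NeZero.ne N)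
  have hγ : 0 < Dictionary.gammaSq S := Dictionary.gammaSq_pos S
  have hγ1 : Dictionary.gammaSq S ≤ 1 := Dictionary.gammaSq_le_one S
  have h1 : 24 / ((N : ℝ) ^ 2 * Dictionary.gammaSq S) ≤ (L : ℝ) ^ M' := (suN_betaTree_div_pow_le_row24_iff S M').1 h
  refine le_trans ?_ h1
  have hN2 : (0 : ℝ) < (N : ℝ) ^ 2 := pow_pos hN 2
  exact div_le_div_of_nonneg_left (by norm_num) (mul_pos hN2 hγ) (mul_le_of_le_one_right hN2.le hγ1)

/-- **For `N ≤ 4` the every-`N` row still forces at least ONE block-RG step beyond Bałaban's `K` at `O(1)` effective coupling (`M' ≠ 0`),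
for every admissible `γ₀` (PROVED arithmetic: `24/N² ≥ 3/2 > 1 = L⁰`).** [cite: Balaban1985UV3, (5) p.256] -/
theorem suN_row24_crossover_pos {N L : ℕ} [NeZero N] (hN4 : N ≤ 4) (S : Scales L) (M' : ℕ)
    (h : betaTree (suGroupModel N) S / (L : ℝ) ^ (S.K + M') ≤ (N : ℝ) * (1 / 24)) : M' ≠ 0 := by
  have h1 : 24 / (N : ℝ) ^ 2 ≤ (L : ℝ) ^ M' := suN_row24_crossover_steps S M' h
  rintro rfl
  rw [pow_zero] at h1
  have hN : (0 : ℝ) < N := by exact_mod_cast Nat.pos_of_ne_zero (NeZero.ne N)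
  have hN4' : (N : ℝ) ≤ 4 := by exact_mod_cast hN4
  have hN2 : (N : ℝ) ^ 2 ≤ 16 := by nlinarith
  have h2 : (24 : ℝ) / 16 ≤ 24 / (N : ℝ) ^ 2 := div_le_div_of_nonneg_left (by norm_num) (pow_pos hN 2) hN2
  linarith

/-- **The conjecture's counted task on the every-`N` TIER-1 row, at the row's ball for the record:** a member whose coupling after `K + M'`
steps lies in this row's window has `24/N² ≤ L^{M'}`. [cite: Balaban1985UV3, (5) p.256] -/
theorem suN_row_star_24_crossover_steps {N L : ℕ} [NeZero N] (S : Scales L) (M' : ℕ)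
    (h : betaTree (suGroupModel N) S / (L : ℝ) ^ (S.K + M') ≤
      (ballOfRobustBallFR N (3 / 50) (3 / 100) 0 ((N : ℝ) * (1 / 24))).βstar) :
    24 / (N : ℝ) ^ 2 ≤ (L : ℝ) ^ M' :=
  suN_row24_crossover_steps S M' h

/-- **The same on the every-`N` TIER-2 row's ball (ball parameter `κ_b = 1/100` for the record).** [cite: Balaban1985UV3, (5) p.256] -/
theorem suN_row_W_star_24_crossover_steps {N L : ℕ} [NeZero N] (S : Scales L) (M' : ℕ)
    (h : betaTree (suGroupModel N) S / (L : ℝ) ^ (S.K + M') ≤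
      (ballOfRobustBall N (1 / 100) (29 / 500) (29 / 1000) ((N : ℝ) * (1 / 24))).βstar) :
    24 / (N : ℝ) ^ 2 ≤ (L : ℝ) ^ M' :=
  suN_row24_crossover_steps S M' h

end Summit.Ventures.YMGap.YM3IR

end
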